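import Summits.QuantumAdvantage.AdviceFreeQNC0.EliminationHardness
import Summits.QuantumAdvantage.AdviceFreeQNC0.WindowDegree
import HarnessLib

/-!
# Cell qa-qnc0 (rung F-Q1, route RingFrame, crux α `RingToElim`): END-SUPPORTED ring strategies
# are eliminators — the first and last `(log₂ n)^C` walk characters do not help

The crux α (`RingHardU` in walk coordinates: a walk strategy `y = (y_g)_{g ≤ n}` of polylog degree
wins the ring game at `u` iff an odd number of the selected positions `g` (`y_g(u) = 1`) carry a
non-zero character `c + g + |u| + |u_{<g}| ≢ 0 (mod 3)`) is open; its content is the use of the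
INTERIOR characters.  This file proves the special case where the strategy selects no interior
position: if `y_g ≡ 0` for `K ≤ g ≤ n − K` with `K ≤ (log₂ n)^C`, the strategy wins on at most
`(1 − η₀)·2ⁿ` inputs, `η₀ > 0` the absolute constant of the tree theorem `elimHard`
(two-bit elimination against `|u| mod 3` is hard at every polylog degree).

Proof.  For a selected LEFT position `g < K` the character is `c + g + |u_{<g}| + w` with
`w = |u|`, and `|u_{<g}|` is a function of `< K` coordinates; for a selected RIGHT position
`g > n − K` it is `c + g + |u| + |u_{<g}| ≡ c + g + 2|u_{≥g}| + 2w (mod 3)`, and `|u_{≥g}|` is a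
function of `< K` coordinates.  So the win bit is `N(u, |u|) mod 2` where
`N(u, w) = #{g selected : A_g(u) + m_g·w ≢ 0 (3)}` with LOCAL data `A_g` and `m_g ∈ {1, 2}`.
Since `w ↦ A + m·w` is a bijection of `ℤ/3`, every selected `g` is counted for exactly two of the
three residues `w`, so `N(u,0) + N(u,1) + N(u,2)` is even and some residue `dec(u)` has
`N(u, dec(u))` even: the strategy LOSES whenever `|u| ≡ dec(u) (mod 3)`.  The residue `dec(u)` is
read off the two bits `[N(u,0) odd]`, `[N(u,1) odd]`, parities of products of a degree-`D` selector
and a function of `< K` coordinates, hence of degree `≤ D + K` (`hasDeg_parity`); the two decoder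
bits have degree `≤ 2(D + K) ≤ (log₂ n)^{C+2}`, and `elimHard` says the decoder names the true
residue on `≥ η₀·2ⁿ` inputs — all of them losses.

* `ringWinU_endSupported_le`: the statement above (`θ = 1 − η₀`, every charge `c`).

The cell's statement (a special case of crux α, qa-qnc0 route RingFrame; the reduction "end
characters are functions of the two extreme characters and `< K` local bits" is the prover's);
not in print.  WHAT THIS IS NOT: nothing on strategies that select interior positions — the
exact optima of the cell's numerics (p2 ROUND-1 §9.16–9.18) show interior characters DO help at
finite `n`; no claim on `RingHardU`, `LDMAPolylog`, `TRPlus` or α; no separation.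
-/

noncomputable section

namespace Summit.QuantumAdvantage.AdviceFreeQNC0

open Finset
open Literature.Computability.MetaComplexity Literature.Computability.MetaComplexity.Smolensky

variable {n : ℕ}

/-! ### The local form of the characters of an end-supported strategy -/

/-- Local form of the character at position `g` (split at `K`): `c + g + W_g(u) + |u|` for
`g < K` and, equivalently mod `3`, `c + g + 2|u_{≥g}| + 2|u|` for `g ≥ K` (`W_g + |u_{≥g}| = |u|`).
(Cell bookkeeping.) -/
theorem endChar_iff (c K : ℕ) (u : Fin n → Bool) (g : Fin (n + 1)) :
    (c + g.val + walkExp u g.val) % 3 ≠ 0 ↔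
      ((if g.val < K then c + g.val + wtPrefix u g.val
        else c + g.val + 2 * (univ.filter fun i : Fin n => g.val ≤ i.val ∧ u i = true).card) +
        (if g.val < K then 1 else 2) * wt u) % 3 ≠ 0 := by
  unfold walkExp
  have hsum := wtPrefix_add_wtSuffix u g.val
  by_cases hK : g.val < K
  · rw [if_pos hK, if_pos hK]
    constructor <;> intro h <;> omega
  · rw [if_neg hK, if_neg hK]
    constructor <;> intro h <;> omega

/-- The hypothetical count `N(u, w)`: selected positions whose character is non-zero if the
total weight were `≡ w`. Stated inline; this lemma records that it only depends on `w mod 3`.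
(Cell bookkeeping.) -/
theorem endCount_mod (c K : ℕ) (y : Fin (n + 1) → (Fin n → Bool) → Bool) (u : Fin n → Bool) (w : ℕ) :
    (univ.filter fun g : Fin (n + 1) => y g u = true ∧
        ((if g.val < K then c + g.val + wtPrefix u g.val
          else c + g.val + 2 * (univ.filter fun i : Fin n => g.val ≤ i.val ∧ u i = true).card) +
          (if g.val < K then 1 else 2) * w) % 3 ≠ 0).card =
    (univ.filter fun g : Fin (n + 1) => y g u = true ∧
        ((if g.val < K then c + g.val + wtPrefix u g.val
          else c + g.val + 2 * (univ.filter fun i : Fin n => g.val ≤ i.val ∧ u i = true).card) +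
          (if g.val < K then 1 else 2) * (w % 3)) % 3 ≠ 0).card := by
  refine congrArg _ (Finset.filter_congr fun g _ => ?_)
  by_cases hK : g.val < K
  · simp only [if_pos hK]; constructor <;> rintro ⟨h1, h2⟩ <;> exact ⟨h1, by omega⟩
  · simp only [if_neg hK]; constructor <;> rintro ⟨h1, h2⟩ <;> exact ⟨h1, by omega⟩

/-- **The win bit is `N(u, |u|) mod 2`**, `N(u, w)` the count of selected positions whose split
character is non-zero at total-weight residue `w` (any strategy, any split point `K`).
(Cell bookkeeping.) -/
theorem ringWinU_eq_endCount (c K : ℕ) (y : Fin (n + 1) → (Fin n → Bool) → Bool) (u : Fin n → Bool) :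
    ringWinU c y u = decide ((univ.filter fun g : Fin (n + 1) => y g u = true ∧
        ((if g.val < K then c + g.val + wtPrefix u g.val
          else c + g.val + 2 * (univ.filter fun i : Fin n => g.val ≤ i.val ∧ u i = true).card) +
          (if g.val < K then 1 else 2) * wt u) % 3 ≠ 0).card % 2 = 1) := by
  have h : (univ.filter fun g : Fin (n + 1) =>
      y g u = true ∧ (c + g.val + walkExp u g.val) % 3 ≠ 0) =
      univ.filter fun g : Fin (n + 1) => y g u = true ∧
        ((if g.val < K then c + g.val + wtPrefix u g.val
          else c + g.val + 2 * (univ.filter fun i : Fin n => g.val ≤ i.val ∧ u i = true).card) +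
          (if g.val < K then 1 else 2) * wt u) % 3 ≠ 0 := by
    refine Finset.filter_congr fun g _ => ?_
    rw [endChar_iff c K u g]
  unfold ringWinU
  rw [h]

/-! ### The parity obstruction: some residue loses -/

/-- For `m ∈ {1, 2}` (mod 3) and any `A`, exactly two of the three residues `w` have
`A + m·w ≢ 0 (mod 3)`. [folklore] -/
theorem sum_three_indicator_eq_two (A m : ℕ) (hm : m % 3 ≠ 0) :
    (∑ w ∈ range 3, if (A + m * w) % 3 ≠ 0 then 1 else 0) = 2 := by
  have hm' : m % 3 = 1 ∨ m % 3 = 2 := by omega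
  have hA : A % 3 = 0 ∨ A % 3 = 1 ∨ A % 3 = 2 := by omega
  simp only [Finset.sum_range_succ, Finset.sum_range_zero]
  rcases hm' with hm' | hm' <;> rcases hA with hA | hA | hA <;> simp [Nat.add_mod, Nat.mul_mod, hm', hA]

/-- **Parity obstruction.** For a family of selected positions with local data `A_g` and
multipliers `m_g ∈ {1,2}`, the three counts `N(w) = #{g : A_g + m_g·w ≢ 0}`, `w = 0,1,2`, sum to
twice the number of selected positions; hence not all three are odd. (Cell statement: "no
selection wins against all three residues".) -/
theorem sum_endCounts_even {ι : Type*} (s : Finset ι) (A m : ι → ℕ) (hm : ∀ g ∈ s, m g % 3 ≠ 0) :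
    (∑ w ∈ range 3, (s.filter fun g => (A g + m g * w) % 3 ≠ 0).card) = 2 * s.card := by
  classical
  simp only [Finset.card_filter]
  rw [Finset.sum_comm]
  rw [Finset.card_eq_sum_ones, Finset.mul_sum]
  refine Finset.sum_congr rfl fun g hg => ?_
  rw [sum_three_indicator_eq_two (A g) (m g) (hm g hg), mul_one]

/-- Hence some residue `w₀ < 3` has an even count. [folklore] -/
theorem exists_endCount_even {ι : Type*} (s : Finset ι) (A m : ι → ℕ) (hm : ∀ g ∈ s, m g % 3 ≠ 0) :
    ∃ w₀, w₀ < 3 ∧ (s.filter fun g => (A g + m g * w₀) % 3 ≠ 0).card % 2 = 0 := by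
  by_contra hno
  push Not at hno
  have h0 := hno 0 (by norm_num)
  have h1 := hno 1 (by norm_num)
  have h2 := hno 2 (by norm_num)
  have hs := sum_endCounts_even s A m hm
  simp only [Finset.sum_range_succ, Finset.sum_range_zero, zero_add] at hs
  omega

/-- The decoder: from the parities of `N(0)` and `N(1)`, a residue with even count
(`0` if `N(0)` is even, else `1` if `N(1)` is even, else `2`). [folklore] -/
theorem decoder_even {ι : Type*} (s : Finset ι) (A m : ι → ℕ) (hm : ∀ g ∈ s, m g % 3 ≠ 0) :
    (s.filter fun g => (A g + m g *
      (if (s.filter fun g => (A g + m g * 0) % 3 ≠ 0).card % 2 = 0 then 0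
        else if (s.filter fun g => (A g + m g * 1) % 3 ≠ 0).card % 2 = 0 then 1 else 2)) % 3 ≠ 0).card
      % 2 = 0 := by
  obtain ⟨w₀, hw₀, heven⟩ := exists_endCount_even s A m hm
  by_cases h0 : (s.filter fun g => (A g + m g * 0) % 3 ≠ 0).card % 2 = 0
  · rw [if_pos h0]; exact h0
  · rw [if_neg h0]
    by_cases h1 : (s.filter fun g => (A g + m g * 1) % 3 ≠ 0).card % 2 = 0
    · rw [if_pos h1]; exact h1
    · rw [if_neg h1]
      interval_cases w₀
      · exact absurd heven h0
      · exact absurd heven h1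
      · exact heven

/-! ### End-supported strategies are eliminators -/

/-- **End-supported ring strategies win on at most `(1 − η₀)·2ⁿ` inputs.**  For every `C` and
all large `n`: if `K ≤ (log₂ n)^C` and the walk strategy `y` (selectors of degree
`≤ (log₂ n)^C`) selects no interior position (`y_g ≡ 0` for `K ≤ g ≤ n − K`), then for every
charge `c` the ring game in walk coordinates is won on at most `θ·2ⁿ` inputs, `θ = 1 − η₀ < 1`
with `η₀` the constant of `elimHard`.  The special case "interior selectors vanish" of the crux
`RingHardU` / α of route RingFrame. (Cell statement; proof = parity obstruction + `elimHard` on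
the two decoder bits, of degree `≤ 2((log₂ n)^C + K) ≤ (log₂ n)^{C+2}`.) -/
theorem ringWinU_endSupported_le :
    ∃ θ : ℝ, θ < 1 ∧ ∀ C : ℕ, ∃ n₀ : ℕ, ∀ n ≥ n₀, ∀ K : ℕ, K ≤ (Nat.log 2 n) ^ C →
      ∀ c : ℕ, ∀ y : Fin (n + 1) → (Fin n → Bool) → Bool,
        (∀ g, HasDeg (y g) ((Nat.log 2 n) ^ C)) →
        (∀ g : Fin (n + 1), K ≤ g.val → g.val + K ≤ n → ∀ u, y g u = false) →
          ((univ.filter fun u : Fin n → Bool => ringWinU c y u = true).card : ℝ) ≤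
            θ * (2 : ℝ) ^ n := by
  classical
  obtain ⟨η₀, hη₀, hE⟩ := elimHard
  refine ⟨1 - η₀, by linarith, fun C => ?_⟩
  obtain ⟨n₀, hn₀⟩ := hE (C + 2)
  refine ⟨max n₀ 4, fun n hn K hK c y hdeg hsupp => ?_⟩
  have hn₀n : n₀ ≤ n := le_trans (le_max_left _ _) hn
  have hn4 : 4 ≤ n := le_trans (le_max_right _ _) hn
  -- local data of the characters
  set D := (Nat.log 2 n) ^ C with hD
  let A : (Fin n → Bool) → Fin (n + 1) → ℕ := fun u g =>
    if g.val < K then c + g.val + wtPrefix u g.val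
    else c + g.val + 2 * (univ.filter fun i : Fin n => g.val ≤ i.val ∧ u i = true).card
  let m : Fin (n + 1) → ℕ := fun g => if g.val < K then 1 else 2
  have hm : ∀ g : Fin (n + 1), m g % 3 ≠ 0 := by
    intro g; by_cases h : g.val < K <;> simp [m, h]
  -- the hypothetical counts and their parities
  let N : (Fin n → Bool) → ℕ → ℕ := fun u w =>
    (univ.filter fun g : Fin (n + 1) => y g u = true ∧ (A u g + m g * w) % 3 ≠ 0).card
  let P : ℕ → (Fin n → Bool) → Bool := fun w u => decide (N u w % 2 = 1)
  -- (1) the win bit is `N(u, |u|) mod 2`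
  have hwin : ∀ u, ringWinU c y u = P (wt u) u := fun u => ringWinU_eq_endCount c K y u
  -- (2) degree of the parity bits: `≤ D + K`
  have hNeq : ∀ w u, N u w = ((univ : Finset (Fin (n + 1))).filter fun g =>
      (y g u && decide ((A u g + m g * w) % 3 ≠ 0)) = true).card := by
    intro w u
    refine congrArg Finset.card ?_
    refine Finset.filter_congr fun g _ => ?_
    rw [Bool.and_eq_true, decide_eq_true_iff]
  have hP : ∀ w, HasDeg (P w) (D + K) := by
    intro w
    have hP' : P w = fun u => decide ((((univ : Finset (Fin (n + 1))).filter fun g =>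
        (y g u && decide ((A u g + m g * w) % 3 ≠ 0)) = true).card) % 2 = 1) := by
      funext u; simp only [P, hNeq w u]
    rw [hP']
    refine hasDeg_parity _ _ fun g _ => ?_
    -- each term: selector (degree `D`) times a window function (degree `≤ K`), or zero
    by_cases hgK : g.val < K
    · -- left end: window `[0, g)`, `g < K`
      have hgn : g.val ≤ n := by omega
      have hwin' : HasDeg (fun u : Fin n → Bool => decide ((A u g + m g * w) % 3 ≠ 0)) K := by
        have h := hasDeg_comp_window (n := n) (Fin.castLE hgn)
          (fun v : Fin g.val → Bool => decide ((c + g.val +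
            (univ.filter fun j : Fin g.val => v j = true).card + 1 * w) % 3 ≠ 0))
        have heq : (fun u : Fin n → Bool => decide ((A u g + m g * w) % 3 ≠ 0)) =
            fun u : Fin n → Bool => (fun v : Fin g.val → Bool => decide ((c + g.val +
              (univ.filter fun j : Fin g.val => v j = true).card + 1 * w) % 3 ≠ 0))
              (fun j => u (Fin.castLE hgn j)) := by
          funext u
          simp only [A, m, if_pos hgK, wtPrefix_eq_card_window u hgn]
        rw [heq]
        exact hasDeg_of_le h (by omega)
      exact hasDeg_and (hdeg g) hwin'
    · by_cases hgR : n < g.val + K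
      · -- right end: window `[g, n)`, fewer than `K` coordinates
        have hgn : g.val ≤ n := by omega
        have hwin' : HasDeg (fun u : Fin n → Bool => decide ((A u g + m g * w) % 3 ≠ 0)) K := by
          have h := hasDeg_comp_window (n := n)
            (fun j : Fin (n - g.val) => (⟨g.val + j.val, by omega⟩ : Fin n))
            (fun v : Fin (n - g.val) → Bool => decide ((c + g.val +
              2 * (univ.filter fun j : Fin (n - g.val) => v j = true).card + 2 * w) % 3 ≠ 0))
          have heq : (fun u : Fin n → Bool => decide ((A u g + m g * w) % 3 ≠ 0)) =
              fun u : Fin n → Bool => (fun v : Fin (n - g.val) → Bool => decide ((c + g.val +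
                2 * (univ.filter fun j : Fin (n - g.val) => v j = true).card + 2 * w) % 3 ≠ 0))
                (fun j => u ⟨g.val + j.val, by omega⟩) := by
            funext u
            simp only [A, m, if_neg hgK, wtSuffix_eq_card_window u hgn]
          rw [heq]
          exact hasDeg_of_le h (by omega)
        exact hasDeg_and (hdeg g) hwin'
      · -- interior: the selector vanishes
        push Not at hgK hgR
        have hzero : (fun u : Fin n → Bool => y g u && decide ((A u g + m g * w) % 3 ≠ 0)) =
            fun _ => false := by
          funext u; rw [hsupp g hgK hgR u, Bool.false_and]
        rw [hzero]
        exact hasDeg_false _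
  -- (3) the decoder bits and their degree `≤ 2(D + K) ≤ (log₂ n)^(C+2)`
  let a : (Fin n → Bool) → Bool := fun u => P 0 u && !P 1 u
  let b : (Fin n → Bool) → Bool := fun u => P 0 u && P 1 u
  have hdegDK : D + K + (D + K) ≤ (Nat.log 2 n) ^ (C + 2) := by
    have hlog : 2 ≤ Nat.log 2 n := by
      have : Nat.log 2 4 ≤ Nat.log 2 n := Nat.log_mono_right hn4
      have h4 : Nat.log 2 4 = 2 := by
        rw [show (4 : ℕ) = 2 ^ 2 by norm_num, Nat.log_pow (by norm_num)]
      omega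
    have hKD : K ≤ D := hK
    calc D + K + (D + K) ≤ 4 * D := by omega
      _ ≤ (Nat.log 2 n) ^ 2 * D := by
          refine Nat.mul_le_mul_right _ ?_
          calc 4 = 2 ^ 2 := by norm_num
            _ ≤ (Nat.log 2 n) ^ 2 := Nat.pow_le_pow_left hlog 2
      _ = (Nat.log 2 n) ^ (C + 2) := by rw [hD, ← pow_add, add_comm]
  have ha : HasDeg a ((Nat.log 2 n) ^ (C + 2)) := hasDeg_of_le (hasDeg_and_not (hP 0) (hP 1)) hdegDK
  have hb : HasDeg b ((Nat.log 2 n) ^ (C + 2)) := hasDeg_of_le (hasDeg_and (hP 0) (hP 1)) hdegDK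
  -- (4) apply `elimHard` to the decoder "`1` if `a`, `2` if `b`, else `0`"
  let dec : ZMod 2 → ZMod 2 → ℕ := fun α β => if α = 1 then 1 else if β = 1 then 2 else 0
  have hElim := hn₀ n hn₀n (fun u => if a u then (1 : ZMod 2) else 0)
    (fun u => if b u then (1 : ZMod 2) else 0) ha hb dec
  -- (5) where the decoder is right, the strategy loses
  have hlose : (univ.filter fun u : Fin n → Bool =>
      dec (if a u then 1 else 0) (if b u then 1 else 0) % 3 = Hegedus.wt u % 3) ⊆
      univ.filter fun u : Fin n → Bool => ¬ ringWinU c y u = true := by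
    intro u hu
    rw [Finset.mem_filter] at hu
    rw [Finset.mem_filter]
    refine ⟨Finset.mem_univ u, ?_⟩
    -- the decoded residue has an even count
    have hdec_even : N u (dec (if a u then 1 else 0) (if b u then 1 else 0)) % 2 = 0 := by
      have key := decoder_even ((univ : Finset (Fin (n + 1))).filter fun g => y g u = true)
        (A u) m (fun g _ => hm g)
      -- rewrite the nested filters as `N u _`
      have hN : ∀ w, (((univ : Finset (Fin (n + 1))).filter fun g => y g u = true).filter
          fun g => (A u g + m g * w) % 3 ≠ 0).card = N u w := by
        intro w; simp only [N, Finset.filter_filter]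
      simp only [hN] at key
      have hdec_bool : ∀ p0 p1 : Bool,
          dec (if (p0 && !p1) = true then 1 else 0) (if (p0 && p1) = true then 1 else 0) =
            (if p0 = false then 0 else if p1 = false then 1 else 2) := by
        intro p0 p1; cases p0 <;> cases p1 <;> simp [dec]
      have hdec : dec (if a u then 1 else 0) (if b u then 1 else 0) =
          (if N u 0 % 2 = 0 then 0 else if N u 1 % 2 = 0 then 1 else 2) := by
        have h := hdec_bool (P 0 u) (P 1 u)
        have e0 : (P 0 u = false) ↔ N u 0 % 2 = 0 := by
          simp only [P, decide_eq_false_iff_not]; omega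
        have e1 : (P 1 u = false) ↔ N u 1 % 2 = 0 := by
          simp only [P, decide_eq_false_iff_not]; omega
        simp only [e0, e1] at h
        exact h
      rw [hdec]
      exact key
    -- and the true residue is the decoded one
    have hwt : Hegedus.wt u = wt u := rfl
    rw [hwin u]
    simp only [P, decide_eq_true_eq]
    have hmod : N u (wt u) = N u (wt u % 3) := endCount_mod c K y u (wt u)
    have hmod' : N u (dec (if a u then 1 else 0) (if b u then 1 else 0)) =
        N u ((dec (if a u then 1 else 0) (if b u then 1 else 0)) % 3) :=
      endCount_mod c K y u _
    rw [hmod, ← hwt, ← hu.2, ← hmod']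
    omega
  -- (6) count
  have hcount : ((univ.filter fun u : Fin n → Bool => ringWinU c y u = true).card : ℝ) +
      ((univ.filter fun u : Fin n → Bool => ¬ ringWinU c y u = true).card : ℝ) = (2 : ℝ) ^ n := by
    have h := Finset.card_filter_add_card_filter_not (s := (univ : Finset (Fin n → Bool)))
      (fun u => ringWinU c y u = true)
    rw [Finset.card_univ, Fintype.card_fun, Fintype.card_bool, Fintype.card_fin] at h
    exact_mod_cast h
  have hge : η₀ * (2 : ℝ) ^ n ≤
      ((univ.filter fun u : Fin n → Bool => ¬ ringWinU c y u = true).card : ℝ) :=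
    hElim.trans (by exact_mod_cast Finset.card_le_card hlose)
  linarith

end Summit.QuantumAdvantage.AdviceFreeQNC0
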